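import Summits.QuantumFields.YangMills.Theorems.BalabanUVNodesPortU8Linearisation
import Literature.MathematicalPhysics.QuantumFieldTheory.Balaban1983to89.MatrixNorms
import Summits.QuantumFields.YangMills.Theorems.BalabanUVNodesPortU8TwoVolume

/-!
# PORT PT-B (U8), file 7 — CURRENCY CONVERSION for the `𝐔`-block of row (R1ᴰ): the three SCALED clauses of print's (4.4) domain `recordDom44J` for the CUT responses,
# FROM bounds on the ENTRYWISE derivative of the rooted-gauge background field (the letter `D` of 27931⁷'s token TokP9dec)

Cell `ym-nodeO-ideate` ∕ `ym-balaban-port`, porter `ymgap-nodeO-port-PTB-1` (gen 0), item **stmt-QuantumFields-27931** `BalabanUVNodes.PortPieceLocalityU8` (string ⁷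
`nodeO-cover/TYPER-Sig27931-v7-J.txt`, sha16 `2b1f3e71e82c2820` = ⁶ + the displayed tokens TokE ∕ TokP9reg ∕ TokP9dec); PORT-PLAN-v1 row U8-C1 (conversion half);
`--kind proof --supports stmt-QuantumFields-27931` (helper).  [I] = [Balaban1987RG1], [15] = [Balaban1985Variational].
CONSUMED BY NAME: files 5–6 (`contDiffAt_recordEmbJ_of`, `contDiffAt_matrix_of_entries`, `exists_ofCLM`, `chartMatU_cutTo_recordGkJ`), pub-balaban's
`MatrixNorms.opNorm_sq_le_sum_norm_sq`, typer-1's `B12FormatPlus.cutTo`, DEF-1's names.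
WHAT THIS FILE PROVES (theorems only; no `def ∕ instance ∕ notation ∕ sorry`; standard axioms).
§1 `norm_of_le_two_mul_norm` — `‖Matrix.of v‖_{L²op} ≤ 2·‖v‖_sup` on `M₂(ℂ)` (⁷'s token measures entries in sup norm, (4.4) measures matrices in operator norm).
§2 `hasFDerivAt_bgField_of_entries` (the `M₂(ℂ)`-valued derivative `U′` from the entrywise one: `U′ δ b = Matrix.of (D δ b)`), ★★ `chartMatU_cutTo_recordGkJ_entries` — on a bond
   `b ∈ X`: `chartMatU (cutTo (recordCXJ X) (recordGkJ … a y)) b = Matrix.of (D b)` with `D := fderiv` of the ENTRY map at `0` in the direction `Pi.single y.1 (Pi.single y.2 (bV a))`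
   — EXACTLY the letter of TokP9dec; ★★ `norm_chartMatU_cutTo_recordGkJ_le` ∕ `norm_chartMatU_diff_cutTo_recordGkJ_le` ∕ `norm_chartMatU_laplace_cutTo_recordGkJ_le` — the value,
   first-difference and Laplacian clauses: a bound `t` on the token's quantity gives `2t` on the corresponding `recordDom44J` quantity of the cut response.
WHAT REMAINS for (R1ᴰ) (said, not done here): the distance conversion `e^{−δ₉·tdist(coarsen b.src, y)} ≤ e^{4δ₉Mc}·e^{−δ₉·distD (y) X}` for `b ∈ X`, the packaging by
`gauge_le_of_mem`, and the `𝐉`-BLOCK clause of `recordDom44J` — which does NOT follow from TokP9dec's three clauses (the linearised current is `ξ⁻³π(−ΔD + ∇div D)`; nodeO STATUS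
00:3xZ, request TokP9cur); and row (R4ᴰ) (two-volume), content with no token.
HONEST FRAMING.  Norm bookkeeping; NOTHING of Bałaban's analysis asserted, ported or discharged; 27931⁷ OPEN; K0⁷ NOT closed; NODE O 0∕1; COUNT 8∕28 · K 1∕4 UNMOVED; finite `𝕋⁴_{L^K}`
at fixed ε — NOT continuum ∕ OS ∕ Clay; **the Yang–Mills mass gap (Clay) is NOT proved by any of this.**
-/

noncomputable section

open scoped BigOperators Matrix.Norms.L2Operator

namespace Summit.QuantumFields.YangMills.Theorems.PortU8

open Literature.MathematicalPhysics.QuantumFieldTheory.Balaban1983to89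
open Literature.MathematicalPhysics.QuantumFieldTheory.Balaban1983to89.Node00
open Literature.MathematicalPhysics.QuantumFieldTheory.Balaban1983to89.T4Continuum (T4Family)
open Summit.QuantumFields.YangMills.Theorems.K0RecordFormatNames

/-! ## §1  `‖Matrix.of v‖_{L²op} ≤ 2·‖v‖_sup` for `2 × 2` matrices -/

/-- For a `2 × 2` complex matrix the L²-operator norm is at most twice the sup norm of its entry array. [folklore] -/
theorem norm_of_le_two_mul_norm (v : Fin 2 → Fin 2 → ℂ) : ‖(Matrix.of v : MatA 2)‖ ≤ 2 * ‖v‖ := by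
  have hsq := MatrixNorms.opNorm_sq_le_sum_norm_sq (Matrix.of v : MatA 2)
  have hent : ∀ i j, ‖(Matrix.of v : MatA 2) i j‖ ≤ ‖v‖ := fun i j => (norm_le_pi_norm (v i) j).trans (norm_le_pi_norm v i)
  have hsum : ∑ i : Fin 2, ∑ j : Fin 2, ‖(Matrix.of v : MatA 2) i j‖ ^ 2 ≤ 4 * ‖v‖ ^ 2 := by
    have h1 : ∀ i j, ‖(Matrix.of v : MatA 2) i j‖ ^ 2 ≤ ‖v‖ ^ 2 := fun i j =>
      pow_le_pow_left₀ (norm_nonneg _) (hent i j) 2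
    calc ∑ i : Fin 2, ∑ j : Fin 2, ‖(Matrix.of v : MatA 2) i j‖ ^ 2 ≤ ∑ i : Fin 2, ∑ j : Fin 2, ‖v‖ ^ 2 :=
          Finset.sum_le_sum fun i _ => Finset.sum_le_sum fun j _ => h1 i j
      _ = 4 * ‖v‖ ^ 2 := by simp [Finset.sum_const, Finset.card_univ]; ring
  have h0 : 0 ≤ ‖v‖ := norm_nonneg v
  nlinarith [norm_nonneg (Matrix.of v : MatA 2), hsq.trans hsum]

/-! ## §2  The derivative of the `M₂(ℂ)`-valued background field from the ENTRYWISE derivative (⁷'s token currency) -/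

/-- The `Matrix.of` identification `(ι → Fin 2 → Fin 2 → ℂ) →L[ℝ] (ι → M₂(ℂ))`, bondwise (finite dimensions). [folklore] -/
theorem exists_ofPiCLM (ι : Type*) [Fintype ι] :
    ∃ e : (ι → Fin 2 → Fin 2 → ℂ) →L[ℝ] (ι → MatA 2), ∀ w b, e w b = Matrix.of (w b) := by
  obtain ⟨eM, heM⟩ := exists_ofCLM
  exact ⟨ContinuousLinearMap.pi fun b => eM.comp (ContinuousLinearMap.proj b), fun w b => by simp [heM]⟩

variable (F : T4Family) (θ : Stage13Params F 2)

/-- **The `M₂(ℂ)`-valued derivative from the entrywise one**: if the ENTRY map `B ↦ (U(B)(b) i i')_{b,i,i'}` is differentiable at `0`, the matrix-valued map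
`B ↦ (U(B)(b))_b` has a derivative `U′` at `0` with `U′ δ b = Matrix.of (D δ b)`, `D := fderiv` of the entry map. [folklore] -/
theorem hasFDerivAt_bgField_of_entries (k K : ℕ)
    (hd : letI := θ.instVβ₁; letI := θ.instVβ₂;
      DifferentiableAt ℝ (fun B : Fin (F.P K).d → Site (F.P K) (k + 1) → θ.Vβ =>
        fun (b : PBond (F.P K) 0) (i i' : Fin 2) => ((recordBgField F θ k K B b : SU 2) : MatA 2) i i') 0) :
    letI := θ.instVβ₁; letI := θ.instVβ₂;
    ∃ U' : (Fin (F.P K).d → Site (F.P K) (k + 1) → θ.Vβ) →L[ℝ] (PBond (F.P K) 0 → MatA 2),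
      (∀ δ b, U' δ b = Matrix.of (fderiv ℝ (fun B : Fin (F.P K).d → Site (F.P K) (k + 1) → θ.Vβ =>
        fun (b : PBond (F.P K) 0) (i i' : Fin 2) => ((recordBgField F θ k K B b : SU 2) : MatA 2) i i') 0 δ b)) ∧
      HasFDerivAt (fun B : Fin (F.P K).d → Site (F.P K) (k + 1) → θ.Vβ => fun b : PBond (F.P K) 0 => ((recordBgField F θ k K B b : SU 2) : MatA 2)) U' 0 := by
  letI := θ.instVβ₁; letI := θ.instVβ₂
  obtain ⟨e, he⟩ := exists_ofPiCLM (PBond (F.P K) 0)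
  refine ⟨e.comp (fderiv ℝ (fun B : Fin (F.P K).d → Site (F.P K) (k + 1) → θ.Vβ =>
      fun (b : PBond (F.P K) 0) (i i' : Fin 2) => ((recordBgField F θ k K B b : SU 2) : MatA 2) i i') 0),
    fun δ b => by rw [ContinuousLinearMap.comp_apply, he], ?_⟩
  refine (e.hasFDerivAt.comp 0 hd.hasFDerivAt).congr_of_eventuallyEq (Filter.Eventually.of_forall fun B => ?_)
  funext b
  rw [Function.comp_apply, he]
  ext i i'
  rfl

/-- ★★ **THE `𝐔`-BLOCK CHART MATRIX OF A CUT RESPONSE IN ⁷'s CURRENCY**: with `D := fderiv` of the ENTRY map at `0` in the direction `δ_{y,a}` (the letter of token TokP9dec),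
on a bond `b ∈ X`: `chartMatU (cutTo (recordCXJ X) (recordGkJ … a y)) b = Matrix.of (D b)`; off `X` it is `0`.  (Entry map differentiable at `0` — e.g. from TokP9reg —,
standing range, `0 < εbg`.) [cite: Balaban1987RG1, (4.4) p.281, (4.35) p.290; Balaban1985Variational, (182) p.307] -/
theorem chartMatU_cutTo_recordGkJ_entries (k K : ℕ) (hk : k + 1 ≤ (F.P K).m + (F.P K).K) (hε : 0 < θ.εbg)
    (hd : letI := θ.instVβ₁; letI := θ.instVβ₂;
      DifferentiableAt ℝ (fun B : Fin (F.P K).d → Site (F.P K) (k + 1) → θ.Vβ =>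
        fun (b : PBond (F.P K) 0) (i i' : Fin 2) => ((recordBgField F θ k K B b : SU 2) : MatA 2) i i') 0)
    (hd2 : letI := θ.instVβ₁; letI := θ.instVβ₂;
      ContDiffAt ℝ 2 (fun B : Fin (F.P K).d → Site (F.P K) (k + 1) → θ.Vβ =>
        fun (b : PBond (F.P K) 0) (i i' : Fin 2) => ((recordBgField F θ k K B b : SU 2) : MatA 2) i i') 0)
    (a : θ.ιβ) (y : RespLabel F k K) {Mc : ℕ} (X : (recordDomSys F Mc k K).Dom) (b : PBond (F.P K) 0) (hb : b ∈ domBonds F Mc k K X) :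
    letI := θ.instVβ₁; letI := θ.instVβ₂; letI := θ.instιβ;
    chartMatU F K (B12FormatPlus.cutTo (recordCXJ F Mc k K X) (recordGkJ F θ k K a y)) b =
      Matrix.of (fderiv ℝ (fun B : Fin (F.P K).d → Site (F.P K) (k + 1) → θ.Vβ =>
        fun (b : PBond (F.P K) 0) (i i' : Fin 2) => ((recordBgField F θ k K B b : SU 2) : MatA 2) i i') 0 (Pi.single y.1 (Pi.single y.2 (θ.bV a))) b) := by
  letI := θ.instVβ₁; letI := θ.instVβ₂; letI := θ.instιβ
  obtain ⟨U', hU'eq, hU'⟩ := hasFDerivAt_bgField_of_entries F θ k K hd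
  have hE : DifferentiableAt ℝ (recordEmbJ F θ k K) 0 :=
    (contDiffAt_recordEmbJ_of F θ k K hk hε (contDiffAt_matrix_of_entries hd2)).differentiableAt (by norm_num)
  have h := chartMatU_cutTo_recordGkJ F θ k K hk hε U' hU' hE a y X b
  rw [if_pos hb, hU'eq] at h
  exact h

/-- ★★ **CURRENCY CONVERSION, FIRST SCALED CLAUSE**: a bound `‖D b‖ ≤ t` on the entrywise derivative (⁷'s TokP9dec shape) gives `‖chartMatU (cutTo … (recordGkJ … a y)) b‖ ≤ 2t`
on every bond of `X` (and the chart matrix vanishes off `X`). [cite: Balaban1987RG1, (4.4) p.281; Balaban1985Variational, (190) p.308] -/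
theorem norm_chartMatU_cutTo_recordGkJ_le (k K : ℕ) (hk : k + 1 ≤ (F.P K).m + (F.P K).K) (hε : 0 < θ.εbg)
    (hd2 : letI := θ.instVβ₁; letI := θ.instVβ₂;
      ContDiffAt ℝ 2 (fun B : Fin (F.P K).d → Site (F.P K) (k + 1) → θ.Vβ =>
        fun (b : PBond (F.P K) 0) (i i' : Fin 2) => ((recordBgField F θ k K B b : SU 2) : MatA 2) i i') 0)
    (a : θ.ιβ) (y : RespLabel F k K) {Mc : ℕ} (X : (recordDomSys F Mc k K).Dom) (b : PBond (F.P K) 0) (hb : b ∈ domBonds F Mc k K X) {t : ℝ}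
    (ht : letI := θ.instVβ₁; letI := θ.instVβ₂; letI := θ.instιβ;
      ‖fderiv ℝ (fun B : Fin (F.P K).d → Site (F.P K) (k + 1) → θ.Vβ =>
        fun (b : PBond (F.P K) 0) (i i' : Fin 2) => ((recordBgField F θ k K B b : SU 2) : MatA 2) i i') 0 (Pi.single y.1 (Pi.single y.2 (θ.bV a))) b‖ ≤ t) :
    letI := θ.instVβ₁; letI := θ.instVβ₂; letI := θ.instιβ;
    ‖chartMatU F K (B12FormatPlus.cutTo (recordCXJ F Mc k K X) (recordGkJ F θ k K a y)) b‖ ≤ 2 * t := by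
  letI := θ.instVβ₁; letI := θ.instVβ₂; letI := θ.instιβ
  rw [chartMatU_cutTo_recordGkJ_entries F θ k K hk hε (hd2.differentiableAt (by norm_num)) hd2 a y X b hb]
  exact (norm_of_le_two_mul_norm _).trans (by linarith)

/-- ★★ **CURRENCY CONVERSION, SECOND SCALED CLAUSE (first differences)**: for two bonds `b, b′` of `X`, a bound `t` on `‖D b′ − D b‖` (⁷'s TokP9dec shape, `b′ = b + e_ν`)
gives `2t` for the difference of the chart matrices of the cut response. [cite: Balaban1987RG1, (4.4) p.281; Balaban1985Variational, (190) p.308] -/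
theorem norm_chartMatU_diff_cutTo_recordGkJ_le (k K : ℕ) (hk : k + 1 ≤ (F.P K).m + (F.P K).K) (hε : 0 < θ.εbg)
    (hd2 : letI := θ.instVβ₁; letI := θ.instVβ₂;
      ContDiffAt ℝ 2 (fun B : Fin (F.P K).d → Site (F.P K) (k + 1) → θ.Vβ =>
        fun (b : PBond (F.P K) 0) (i i' : Fin 2) => ((recordBgField F θ k K B b : SU 2) : MatA 2) i i') 0)
    (a : θ.ιβ) (y : RespLabel F k K) {Mc : ℕ} (X : (recordDomSys F Mc k K).Dom) (b b' : PBond (F.P K) 0)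
    (hb : b ∈ domBonds F Mc k K X) (hb' : b' ∈ domBonds F Mc k K X) {t : ℝ}
    (ht : letI := θ.instVβ₁; letI := θ.instVβ₂; letI := θ.instιβ;
      letI D := fderiv ℝ (fun B : Fin (F.P K).d → Site (F.P K) (k + 1) → θ.Vβ =>
        fun (b : PBond (F.P K) 0) (i i' : Fin 2) => ((recordBgField F θ k K B b : SU 2) : MatA 2) i i') 0 (Pi.single y.1 (Pi.single y.2 (θ.bV a)));
      ‖D b' - D b‖ ≤ t) :
    letI := θ.instVβ₁; letI := θ.instVβ₂; letI := θ.instιβ;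
    ‖chartMatU F K (B12FormatPlus.cutTo (recordCXJ F Mc k K X) (recordGkJ F θ k K a y)) b' -
      chartMatU F K (B12FormatPlus.cutTo (recordCXJ F Mc k K X) (recordGkJ F θ k K a y)) b‖ ≤ 2 * t := by
  letI := θ.instVβ₁; letI := θ.instVβ₂; letI := θ.instιβ
  have key : chartMatU F K (B12FormatPlus.cutTo (recordCXJ F Mc k K X) (recordGkJ F θ k K a y)) b' -
      chartMatU F K (B12FormatPlus.cutTo (recordCXJ F Mc k K X) (recordGkJ F θ k K a y)) b =
      Matrix.of (fderiv ℝ (fun B : Fin (F.P K).d → Site (F.P K) (k + 1) → θ.Vβ =>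
          fun (b : PBond (F.P K) 0) (i i' : Fin 2) => ((recordBgField F θ k K B b : SU 2) : MatA 2) i i') 0 (Pi.single y.1 (Pi.single y.2 (θ.bV a))) b' -
        fderiv ℝ (fun B : Fin (F.P K).d → Site (F.P K) (k + 1) → θ.Vβ =>
          fun (b : PBond (F.P K) 0) (i i' : Fin 2) => ((recordBgField F θ k K B b : SU 2) : MatA 2) i i') 0 (Pi.single y.1 (Pi.single y.2 (θ.bV a))) b) := by
    rw [chartMatU_cutTo_recordGkJ_entries F θ k K hk hε (hd2.differentiableAt (by norm_num)) hd2 a y X b hb,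
      chartMatU_cutTo_recordGkJ_entries F θ k K hk hε (hd2.differentiableAt (by norm_num)) hd2 a y X b' hb']
    rfl
  rw [key]
  exact (norm_of_le_two_mul_norm _).trans (by linarith)

/-- ★★ **CURRENCY CONVERSION, THIRD SCALED CLAUSE (Laplacian)**: for a bond `b` of `X` all of whose `2d` neighbours `b ± e_ν` are bonds of `X`, a bound `t` on the entrywise
Laplacian `‖Σ_ν (D(b+e_ν) − 2D(b) + D(b−e_ν))‖` (⁷'s TokP9dec shape) gives `2t` for the chart matrices of the cut response. [cite: Balaban1987RG1, (4.4) p.281; Balaban1985Variational, (190) p.308] -/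
theorem norm_chartMatU_laplace_cutTo_recordGkJ_le (k K : ℕ) (hk : k + 1 ≤ (F.P K).m + (F.P K).K) (hε : 0 < θ.εbg)
    (hd2 : letI := θ.instVβ₁; letI := θ.instVβ₂;
      ContDiffAt ℝ 2 (fun B : Fin (F.P K).d → Site (F.P K) (k + 1) → θ.Vβ =>
        fun (b : PBond (F.P K) 0) (i i' : Fin 2) => ((recordBgField F θ k K B b : SU 2) : MatA 2) i i') 0)
    (a : θ.ιβ) (y : RespLabel F k K) {Mc : ℕ} (X : (recordDomSys F Mc k K).Dom) (b : PBond (F.P K) 0) (hb : b ∈ domBonds F Mc k K X)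
    (hnb : ∀ ν : Fin (F.P K).d, (⟨b.src.shift ν, b.dir⟩ : PBond (F.P K) 0) ∈ domBonds F Mc k K X ∧ (⟨b.src.unshift ν, b.dir⟩ : PBond (F.P K) 0) ∈ domBonds F Mc k K X)
    {t : ℝ}
    (ht : letI := θ.instVβ₁; letI := θ.instVβ₂; letI := θ.instιβ;
      letI D := fderiv ℝ (fun B : Fin (F.P K).d → Site (F.P K) (k + 1) → θ.Vβ =>
        fun (b : PBond (F.P K) 0) (i i' : Fin 2) => ((recordBgField F θ k K B b : SU 2) : MatA 2) i i') 0 (Pi.single y.1 (Pi.single y.2 (θ.bV a)));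
      ‖∑ ν : Fin (F.P K).d, (D ⟨b.src.shift ν, b.dir⟩ - (2 : ℂ) • D b + D ⟨b.src.unshift ν, b.dir⟩)‖ ≤ t) :
    letI := θ.instVβ₁; letI := θ.instVβ₂; letI := θ.instιβ;
    ‖∑ ν : Fin (F.P K).d, (chartMatU F K (B12FormatPlus.cutTo (recordCXJ F Mc k K X) (recordGkJ F θ k K a y)) ⟨b.src.shift ν, b.dir⟩ -
        (2 : ℂ) • chartMatU F K (B12FormatPlus.cutTo (recordCXJ F Mc k K X) (recordGkJ F θ k K a y)) b +
        chartMatU F K (B12FormatPlus.cutTo (recordCXJ F Mc k K X) (recordGkJ F θ k K a y)) ⟨b.src.unshift ν, b.dir⟩)‖ ≤ 2 * t := by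
  letI := θ.instVβ₁; letI := θ.instVβ₂; letI := θ.instιβ
  have h0 := chartMatU_cutTo_recordGkJ_entries F θ k K hk hε (hd2.differentiableAt (by norm_num)) hd2 a y X b hb
  have hs : ∀ ν : Fin (F.P K).d,
      chartMatU F K (B12FormatPlus.cutTo (recordCXJ F Mc k K X) (recordGkJ F θ k K a y)) ⟨b.src.shift ν, b.dir⟩ =
        Matrix.of (fderiv ℝ (fun B : Fin (F.P K).d → Site (F.P K) (k + 1) → θ.Vβ =>
          fun (b : PBond (F.P K) 0) (i i' : Fin 2) => ((recordBgField F θ k K B b : SU 2) : MatA 2) i i') 0 (Pi.single y.1 (Pi.single y.2 (θ.bV a)))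
          ⟨b.src.shift ν, b.dir⟩) := fun ν =>
    chartMatU_cutTo_recordGkJ_entries F θ k K hk hε (hd2.differentiableAt (by norm_num)) hd2 a y X _ (hnb ν).1
  have hu : ∀ ν : Fin (F.P K).d,
      chartMatU F K (B12FormatPlus.cutTo (recordCXJ F Mc k K X) (recordGkJ F θ k K a y)) ⟨b.src.unshift ν, b.dir⟩ =
        Matrix.of (fderiv ℝ (fun B : Fin (F.P K).d → Site (F.P K) (k + 1) → θ.Vβ =>
          fun (b : PBond (F.P K) 0) (i i' : Fin 2) => ((recordBgField F θ k K B b : SU 2) : MatA 2) i i') 0 (Pi.single y.1 (Pi.single y.2 (θ.bV a)))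
          ⟨b.src.unshift ν, b.dir⟩) := fun ν =>
    chartMatU_cutTo_recordGkJ_entries F θ k K hk hε (hd2.differentiableAt (by norm_num)) hd2 a y X _ (hnb ν).2
  have key : ∑ ν : Fin (F.P K).d, (chartMatU F K (B12FormatPlus.cutTo (recordCXJ F Mc k K X) (recordGkJ F θ k K a y)) ⟨b.src.shift ν, b.dir⟩ -
        (2 : ℂ) • chartMatU F K (B12FormatPlus.cutTo (recordCXJ F Mc k K X) (recordGkJ F θ k K a y)) b +
        chartMatU F K (B12FormatPlus.cutTo (recordCXJ F Mc k K X) (recordGkJ F θ k K a y)) ⟨b.src.unshift ν, b.dir⟩) =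
      Matrix.of (∑ ν : Fin (F.P K).d,
        (fderiv ℝ (fun B : Fin (F.P K).d → Site (F.P K) (k + 1) → θ.Vβ =>
            fun (b : PBond (F.P K) 0) (i i' : Fin 2) => ((recordBgField F θ k K B b : SU 2) : MatA 2) i i') 0 (Pi.single y.1 (Pi.single y.2 (θ.bV a)))
            ⟨b.src.shift ν, b.dir⟩ -
          (2 : ℂ) • fderiv ℝ (fun B : Fin (F.P K).d → Site (F.P K) (k + 1) → θ.Vβ =>
            fun (b : PBond (F.P K) 0) (i i' : Fin 2) => ((recordBgField F θ k K B b : SU 2) : MatA 2) i i') 0 (Pi.single y.1 (Pi.single y.2 (θ.bV a))) b +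
          fderiv ℝ (fun B : Fin (F.P K).d → Site (F.P K) (k + 1) → θ.Vβ =>
            fun (b : PBond (F.P K) 0) (i i' : Fin 2) => ((recordBgField F θ k K B b : SU 2) : MatA 2) i i') 0 (Pi.single y.1 (Pi.single y.2 (θ.bV a)))
            ⟨b.src.unshift ν, b.dir⟩)) := by
    simp only [h0, hs, hu]
    ext i j
    simp [Matrix.sum_apply, Finset.sum_apply]
  rw [key]
  exact (norm_of_le_two_mul_norm _).trans (by linarith)

end Summit.QuantumFields.YangMills.Theorems.PortU8

end
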